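import Summits.AnomalousDissipation.AnomalousDissipation.Theorems.SawtoothPulseCascadeK3LocalisedClosureApproxReduction
import HarnessLib

/-!
# K3loc, line `DriftFree` — helper: `ApproximateSolution` is EQUIVALENT to the `L²` slaving estimate of the true
# planar Navier–Stokes solution

Helper file of the lead prover (gen 2) for the crux `K3LocalisedClosure` (stmt-AnomalousDissipation-19492), route
`SawtoothPulseCascade`, line `DriftFree` (skeleton v3.1), stub `stub_approximateSolution` (XL, load-bearing):
`K2LinearisedCascadeGrowth → ∀ box, DriftFree.ApproximateSolution ⟨γ, 1/4, 2, 1, ρN⟩ (γ² − 3)`.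

The predicate `DriftFree.ApproximateSolution P r` (Grenier's scheme: a classical solution `U` of Navier–Stokes with
force `∂ₜū + ρ` from rest, a continuous strain bound `Λ` of `U`, `∫₀ᵀ ‖U − ū‖² ≤ εν` and
`(∫₀ᵗ e^{∫ₛᵗΛ⁺}‖ρ(s)‖ ds)² ≤ εν` on the localised window `[0, T]`, `T = horizon r ν A`) is shown to be EQUIVALENT —
given global classical solvability of the forced planar system from rest on `[0,1)`, which is the line's stub
`stub_existence` — to the bare slaving estimate on the TRUE solution:

  `(E)  ∀ A ε, ε > 0 → ∃ ν₀ > 0, ∀ ν ∈ (0, ν₀], every classical solution V of NS_ν(∂ₜū) on [0,1) × 𝕋² with V(0) = 0`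
  `     satisfies ∫₀^{horizon r ν A} ‖V(s) − ū(s)‖²_{L²} ds ≤ ε ν.`

* `approximateSolution_of_slaving` (⇐): the true solution IS an approximate solution with NO defect — witness
  `U = V`, `ρ = 0`, `q = φ`, `Λ ≡ C` a constant strain bound of the smooth `V` on the compact `[0, T] × 𝕋²`
  (`exists_strainBound`, joint smoothness ⇒ bounded partial derivatives); the Duhamel–Grönwall defect of `ρ = 0`
  vanishes identically, so of the eight conjuncts only `∫₀ᵀ‖V − ū‖² ≤ εν` carries content;
* `slaving_of_approximateSolution` (⇒): energy stability (`DriftFree.nsEnergyStability`, tree) gives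
  `‖V(t) − U(t)‖² ≤ (defect)² ≤ εν/4` on `[0, T]`, and `‖V − ū‖² ≤ 2‖V − U‖² + 2‖U − ū‖²`, `T ≤ 1`;
* `approximateSolution_iff_slaving`: the equivalence under solvability from rest on `[0,1)` for every `ν > 0`
  (first conjunct of `DriftFree.Existence P`; `approximateSolution_iff_slaving_of_existence`).

Consequence for the tenure planner's split (SPLIT-PLAN §v5, child `ApproxSol58`): the child may be typed as the pure
a priori estimate (E) on the box — no approximate solution, strain function or defect functional in its statement —
and `K2″`'s whole job is (E).  Nothing here is the crux; no definition, no named fact, no `sorry`.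
-/

-- `Summit.<Summit>.<Problem>`: single-conjunct summit, the duplicate namespace segment is deliberate.
set_option linter.dupNamespace false

noncomputable section

namespace Summit.AnomalousDissipation.AnomalousDissipation.Theorems.SawtoothPulseCascade.DriftFreeApprox

open scoped InnerProductSpace ENNReal NNReal
open MeasureTheory Set Filter Topology
open Literature.Analysis Literature.Analysis.FunctionSpaces Literature.Analysis.FluidPDE
open Literature.Analysis.FluidPDE.SawtoothCascade
open Literature.Analysis.FluidPDE.SawtoothCascade.DriftFree

/-! ## §B1 A constant strain bound for a jointly smooth planar field on a compact time set -/

/-- **Strain bound from joint smoothness.** A field `V` jointly smooth on `S × 𝕋²` (`S` of unique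
differentiability) has, on every compact `K ⊆ S`, a constant one-sided strain bound
`⟪ξ, (ξ·∇)V(t,x)⟫ ≤ C‖ξ‖²` (`C = Σᵢ sup_{K × 𝕋²} ‖∂ᵢV‖`; bounded partial derivatives on the compact set,
`Df(x)ξ = Σᵢ ξᵢ ∂ᵢf(x)`, Cauchy–Schwarz). [folklore] -/
theorem exists_strainBound {S K : Set ℝ} {V : ℝ → UnitAddTorus (Fin 2) → EuclideanSpace ℝ (Fin 2)}
    (hV : FunctionSpaces.Torus.IsSmoothSpaceTimeOn S V) (hS : UniqueDiffOn ℝ S) (hK : IsCompact K)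
    (hKS : K ⊆ S) :
    ∃ C : ℝ, 0 ≤ C ∧ ∀ t ∈ K, ∀ (x : UnitAddTorus (Fin 2)) (ξ : EuclideanSpace ℝ (Fin 2)),
      ⟪ξ, FunctionSpaces.Torus.convect (fun _ => ξ) (V t) x⟫_ℝ ≤ C * ‖ξ‖ ^ 2 := by
  have hM : ∀ i : Fin 2, ∃ C : ℝ, ∀ t ∈ K, ∀ x, ‖FunctionSpaces.Torus.partialDeriv i (V t) x‖ ≤ C :=
    fun i => (hV.partialDeriv hS i).exists_norm_le_of_isCompact hK hKS
  choose M hM using hM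
  refine ⟨∑ i, |M i|, Finset.sum_nonneg fun i _ => abs_nonneg _, fun t ht x ξ => ?_⟩
  have h1 : FunctionSpaces.Torus.IsContDiff 1 (V t) := (hV.isSmooth_slice (hKS ht)).isContDiff (by simp)
  have hconv : FunctionSpaces.Torus.convect (fun _ => ξ) (V t) x = FunctionSpaces.Torus.fderiv (V t) x ξ := rfl
  have hnorm : ‖FunctionSpaces.Torus.fderiv (V t) x ξ‖ ≤ (∑ i, |M i|) * ‖ξ‖ := by
    rw [FunctionSpaces.Torus.fderiv_apply_eq_sum_partialDeriv h1 x ξ, Finset.sum_mul]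
    refine (norm_sum_le _ _).trans (Finset.sum_le_sum fun i _ => ?_)
    rw [norm_smul]
    have hξi : ‖ξ i‖ ≤ ‖ξ‖ := PiLp.norm_apply_le ξ i
    calc ‖ξ i‖ * ‖FunctionSpaces.Torus.partialDeriv i (V t) x‖ ≤ ‖ξ‖ * |M i| :=
          mul_le_mul hξi ((hM i t ht x).trans (le_abs_self _)) (norm_nonneg _) (norm_nonneg _)
      _ = |M i| * ‖ξ‖ := mul_comm _ _
  rw [hconv]
  calc ⟪ξ, FunctionSpaces.Torus.fderiv (V t) x ξ⟫_ℝ ≤ ‖ξ‖ * ‖FunctionSpaces.Torus.fderiv (V t) x ξ‖ :=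
        real_inner_le_norm _ _
    _ ≤ ‖ξ‖ * ((∑ i, |M i|) * ‖ξ‖) := mul_le_mul_of_nonneg_left hnorm (norm_nonneg _)
    _ = (∑ i, |M i|) * ‖ξ‖ ^ 2 := by ring

/-! ## §B2 `ApproximateSolution` from the slaving estimate of the true solution (no defect) -/

/-- **`ApproximateSolution P r` from the `L²` slaving estimate of the TRUE solution.**  If for every lag `A` and
`ε > 0`, for all small `ν`, there is a classical solution `V` of the planar Navier–Stokes system with force
`planarForce P = ∂ₜū` from rest on `[0,1) × 𝕋²` with `∫₀ᵀ ‖V(s) − ū(s)‖²_{L²} ds ≤ εν`, `T = horizon r ν A`, then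
`ApproximateSolution P r` holds — with the defect-free witness `U = V`, `ρ = 0`, `q = φ`, `Λ ≡ C` (a constant
strain bound of `V` on the compact `[0, T] × 𝕋²`, `exists_strainBound`): the Duhamel–Grönwall functional of the
zero defect vanishes.  (Grenier's scheme read backwards: the exact solution is the best approximate solution.)
[folklore] -/
theorem approximateSolution_of_slaving (P : CascadeParams) (hδ₀ : 0 < P.δ₀) (hd : 0 < P.d) {r : ℝ}
    (h : ∀ A : ℕ, ∀ ε : ℝ, 0 < ε → ∃ ν₀ : ℝ, 0 < ν₀ ∧ ∀ ν ∈ Ioc 0 ν₀,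
      ∃ (V : ℝ → UnitAddTorus (Fin 2) → EuclideanSpace ℝ (Fin 2)) (φ : ℝ → UnitAddTorus (Fin 2) → ℝ),
        FunctionSpaces.Torus.IsClassicalNSSolutionOn (Ico (0 : ℝ) 1) ν (planarForce P) V φ ∧ V 0 = 0 ∧
        (∫ s in (0 : ℝ)..horizon r ν A, FluidPDE.Torus.vectorL2Sq (V s - P.field s)) ≤ ε * ν) :
    ApproximateSolution P r := by
  intro A ε hε
  obtain ⟨ν₀, hν₀, hν⟩ := h A ε hε
  refine ⟨ν₀, hν₀, fun ν hνm => ?_⟩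
  obtain ⟨V, φ, hV, hV0, hint⟩ := hν ν hνm
  have hfs : CascadeFieldSmooth P := cascadeFieldSmooth P hδ₀ hd
  have hU1 : UniqueDiffOn ℝ (Ico (0 : ℝ) 1) := uniqueDiffOn_Ico 0 1
  have hconv : Convex ℝ (Ico (0 : ℝ) 1) := convex_Ico 0 1
  set T := horizon r ν A with hT
  have hT1 : T < 1 := CascadeParams.tStart_lt_one _
  have hI : Icc 0 T ⊆ Ico (0 : ℝ) 1 := fun s hs => ⟨hs.1, hs.2.trans_lt hT1⟩
  obtain ⟨C, -, hC⟩ := exists_strainBound hV.smooth_velocity hU1 isCompact_Icc hI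
  have hεν : 0 ≤ ε * ν := (mul_pos hε hνm.1).le
  have hV' : FunctionSpaces.Torus.IsClassicalNSSolutionOn (Ico (0 : ℝ) 1) ν (planarForce P + 0) V φ := by
    rwa [add_zero]
  have hρ0 : ∀ s : ℝ, Real.sqrt (FluidPDE.Torus.vectorL2Sq
      ((0 : ℝ → UnitAddTorus (Fin 2) → EuclideanSpace ℝ (Fin 2)) s)) = 0 := fun s => by
    simp [FluidPDE.Torus.vectorL2Sq]
  refine ⟨V, 0, φ, fun _ => C, hV', hV0, hC, continuousOn_const, ?_, ?_, hint, ?_⟩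
  · simp only [hρ0]; exact continuousOn_const
  · exact (((hV.smooth_velocity.sub hfs).continuousOn_integral_norm_sq hconv).mono hI).congr fun s _ => by
      simp only [FluidPDE.Torus.vectorL2Sq, Pi.sub_apply]
  · intro t _
    have h0 : duhamelDefect (fun _ => C) 0 t = 0 := by
      simp only [duhamelDefect, hρ0, mul_zero, intervalIntegral.integral_zero]
    rw [h0]; simpa using hεν

/-! ## §B3 The slaving estimate from `ApproximateSolution` (energy stability) -/

/-- **The `L²` slaving estimate of the true solution from `ApproximateSolution P r`.**  If `ApproximateSolution P r`
holds then for every `A`, `ε > 0` and all small `ν`, EVERY classical solution `V` of planar Navier–Stokes with force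
`∂ₜū` from rest on `[0,1) × 𝕋²` satisfies `∫₀ᵀ ‖V(s) − ū(s)‖²_{L²} ds ≤ εν`, `T = horizon r ν A`: take the
approximate solution `(U, ρ, Λ)` at `ε/4`; energy stability (`DriftFree.nsEnergyStability`, Majda–Bertozzi Prop. 3.1
in Duhamel form) gives `‖V(t) − U(t)‖² ≤ (∫₀ᵗe^{∫Λ⁺}‖ρ‖)² ≤ εν/4` on `[0, T]`, and
`‖V − ū‖² ≤ 2‖V − U‖² + 2‖U − ū‖²` with `T ≤ 1`. [folklore] -/
theorem slaving_of_approximateSolution (P : CascadeParams) (hδ₀ : 0 < P.δ₀) (hd : 0 < P.d) {r : ℝ}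
    (h : ApproximateSolution P r) :
    ∀ A : ℕ, ∀ ε : ℝ, 0 < ε → ∃ ν₀ : ℝ, 0 < ν₀ ∧ ∀ ν ∈ Ioc 0 ν₀,
      ∀ (V : ℝ → UnitAddTorus (Fin 2) → EuclideanSpace ℝ (Fin 2)) (φ : ℝ → UnitAddTorus (Fin 2) → ℝ),
        FunctionSpaces.Torus.IsClassicalNSSolutionOn (Ico (0 : ℝ) 1) ν (planarForce P) V φ → V 0 = 0 →
          (∫ s in (0 : ℝ)..horizon r ν A, FluidPDE.Torus.vectorL2Sq (V s - P.field s)) ≤ ε * ν := by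
  intro A ε hε
  obtain ⟨ν₀, hν₀, hAS⟩ := h A (ε / 4) (by positivity)
  refine ⟨ν₀, hν₀, fun ν hνm V φ hV hV0 => ?_⟩
  have hνpos : 0 < ν := hνm.1
  have hfs : CascadeFieldSmooth P := cascadeFieldSmooth P hδ₀ hd
  have hconv : Convex ℝ (Ico (0 : ℝ) 1) := convex_Ico 0 1
  set T := horizon r ν A with hTdef
  have hT0 : 0 ≤ T := CascadeParams.tStart_nonneg _
  have hT1 : T < 1 := CascadeParams.tStart_lt_one _
  have hI : Icc 0 T ⊆ Ico (0 : ℝ) 1 := fun s hs => ⟨hs.1, hs.2.trans_lt hT1⟩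
  obtain ⟨U, ρ, q, Λ, hU, hU0, hStr, hΛc, hρc, hUc, hUint, hdef⟩ := hAS ν hνm
  -- energy stability: ‖V − U‖² ≤ (ε/4) ν on [0, T]
  have hVU : ∀ s ∈ Icc 0 T, FluidPDE.Torus.vectorL2Sq (V s - U s) ≤ ε / 4 * ν := by
    intro s hs
    have h1 := nsEnergyStability (Ico (0 : ℝ) 1) ν T (planarForce P) ρ U V q φ Λ hνpos.le hT0
      hconv hI hU hV (by rw [hU0, hV0]) hStr hΛc hρc s hs
    have h2 : FluidPDE.Torus.vectorL2Sq (V s - U s) = Real.sqrt (FluidPDE.Torus.vectorL2Sq (V s - U s)) ^ 2 :=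
      (Real.sq_sqrt (integral_nonneg fun _ => sq_nonneg _)).symm
    rw [h2]
    have h0 : 0 ≤ duhamelDefect Λ ρ s :=
      (Real.sqrt_nonneg _).trans h1
    exact (pow_le_pow_left₀ (Real.sqrt_nonneg _) h1 2).trans (hdef s hs)
  have hVs := hV.smooth_velocity
  have hUs := hU.smooth_velocity
  -- pointwise in time: ‖V − ū‖² ≤ 2‖V − U‖² + 2‖U − ū‖²
  have hdiff : ∀ s ∈ Icc 0 T, FluidPDE.Torus.vectorL2Sq (V s - P.field s) ≤
      2 * (ε / 4 * ν) + 2 * FluidPDE.Torus.vectorL2Sq (U s - P.field s) := by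
    intro s hs
    have hs' : s ∈ Ico (0 : ℝ) 1 := hI hs
    have cV : Continuous (V s) := (hVs.isSmooth_slice hs').continuous
    have cU : Continuous (U s) := (hUs.isSmooth_slice hs').continuous
    have cF : Continuous (P.field s) := (hfs.isSmooth_slice hs').continuous
    have hpt : ∀ x, ‖V s x - P.field s x‖ ^ 2 ≤ 2 * ‖V s x - U s x‖ ^ 2 + 2 * ‖U s x - P.field s x‖ ^ 2 := by
      intro x
      have e : V s x - P.field s x = (V s x - U s x) + (U s x - P.field s x) := by abel
      rw [e]
      have h := norm_add_le (V s x - U s x) (U s x - P.field s x)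
      have h2 := pow_le_pow_left₀ (norm_nonneg _) h 2
      nlinarith [sq_nonneg (‖V s x - U s x‖ - ‖U s x - P.field s x‖)]
    have c0 : Continuous fun x => ‖V s x - P.field s x‖ ^ 2 := by fun_prop
    have c1 : Continuous fun x => 2 * ‖V s x - U s x‖ ^ 2 := by fun_prop
    have c2 : Continuous fun x => 2 * ‖U s x - P.field s x‖ ^ 2 := by fun_prop
    calc FluidPDE.Torus.vectorL2Sq (V s - P.field s) = ∫ x, ‖V s x - P.field s x‖ ^ 2 := by
          simp only [FluidPDE.Torus.vectorL2Sq, Pi.sub_apply]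
      _ ≤ ∫ x, (2 * ‖V s x - U s x‖ ^ 2 + 2 * ‖U s x - P.field s x‖ ^ 2) :=
          integral_mono c0.integrable_unitAddTorus (c1.add c2).integrable_unitAddTorus hpt
      _ = 2 * FluidPDE.Torus.vectorL2Sq (V s - U s) + 2 * FluidPDE.Torus.vectorL2Sq (U s - P.field s) := by
          rw [integral_add c1.integrable_unitAddTorus c2.integrable_unitAddTorus,
            integral_const_mul, integral_const_mul]
          simp only [FluidPDE.Torus.vectorL2Sq, Pi.sub_apply]
      _ ≤ 2 * (ε / 4 * ν) + 2 * FluidPDE.Torus.vectorL2Sq (U s - P.field s) := by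
          linarith [hVU s hs]
  have hdc : ContinuousOn (fun s => FluidPDE.Torus.vectorL2Sq (V s - P.field s)) (Icc 0 T) :=
    (((hVs.sub hfs).continuousOn_integral_norm_sq hconv).mono hI).congr fun s _ => by
      simp only [FluidPDE.Torus.vectorL2Sq, Pi.sub_apply]
  have hTsub : uIcc 0 T ⊆ Icc 0 T := by rw [uIcc_of_le hT0]
  have i1 : IntervalIntegrable (fun s => FluidPDE.Torus.vectorL2Sq (V s - P.field s)) volume 0 T :=
    (hdc.mono hTsub).intervalIntegrable
  have i2 : IntervalIntegrable (fun s => 2 * (ε / 4 * ν) + 2 * FluidPDE.Torus.vectorL2Sq (U s - P.field s))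
      volume 0 T :=
    intervalIntegrable_const.add ((hUc.mono hTsub).intervalIntegrable.const_mul 2)
  have h1 := intervalIntegral.integral_mono_on hT0 i1 i2 hdiff
  rw [intervalIntegral.integral_add intervalIntegrable_const ((hUc.mono hTsub).intervalIntegrable.const_mul 2),
    intervalIntegral.integral_const, intervalIntegral.integral_const_mul, smul_eq_mul] at h1
  have hT1' : T - 0 ≤ 1 := by linarith
  have hεν : 0 ≤ ε / 4 * ν := by positivity
  nlinarith [hUint]

/-! ## §B4 The equivalence -/

/-- **`ApproximateSolution P r` ⇔ the slaving estimate (E)**, given classical solvability of planar Navier–Stokes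
with force `∂ₜū` from rest on `[0,1) × 𝕋²` for every `ν > 0` (2D global regularity; the line's `stub_existence`).
[folklore] -/
theorem approximateSolution_iff_slaving (P : CascadeParams) (hδ₀ : 0 < P.δ₀) (hd : 0 < P.d) {r : ℝ}
    (hEx : ∀ ν : ℝ, 0 < ν →
      ∃ (V : ℝ → UnitAddTorus (Fin 2) → EuclideanSpace ℝ (Fin 2)) (φ : ℝ → UnitAddTorus (Fin 2) → ℝ),
        FunctionSpaces.Torus.IsClassicalNSSolutionOn (Ico (0 : ℝ) 1) ν (planarForce P) V φ ∧ V 0 = 0) :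
    ApproximateSolution P r ↔
      ∀ A : ℕ, ∀ ε : ℝ, 0 < ε → ∃ ν₀ : ℝ, 0 < ν₀ ∧ ∀ ν ∈ Ioc 0 ν₀,
        ∀ (V : ℝ → UnitAddTorus (Fin 2) → EuclideanSpace ℝ (Fin 2)) (φ : ℝ → UnitAddTorus (Fin 2) → ℝ),
          FunctionSpaces.Torus.IsClassicalNSSolutionOn (Ico (0 : ℝ) 1) ν (planarForce P) V φ → V 0 = 0 →
            (∫ s in (0 : ℝ)..horizon r ν A, FluidPDE.Torus.vectorL2Sq (V s - P.field s)) ≤ ε * ν := by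
  refine ⟨slaving_of_approximateSolution P hδ₀ hd, fun h => approximateSolution_of_slaving P hδ₀ hd ?_⟩
  intro A ε hε
  obtain ⟨ν₀, hν₀, hν⟩ := h A ε hε
  refine ⟨ν₀, hν₀, fun ν hνm => ?_⟩
  obtain ⟨V, φ, hV, hV0⟩ := hEx ν hνm.1
  exact ⟨V, φ, hV, hV0, hν ν hνm V φ hV hV0⟩

/-- The same equivalence with the solvability hypothesis read off `DriftFree.Existence P` (its first conjunct).
[folklore] -/
theorem approximateSolution_iff_slaving_of_existence (P : CascadeParams) (hδ₀ : 0 < P.δ₀) (hd : 0 < P.d)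
    {r : ℝ} (hEx : Existence P) :
    ApproximateSolution P r ↔
      ∀ A : ℕ, ∀ ε : ℝ, 0 < ε → ∃ ν₀ : ℝ, 0 < ν₀ ∧ ∀ ν ∈ Ioc 0 ν₀,
        ∀ (V : ℝ → UnitAddTorus (Fin 2) → EuclideanSpace ℝ (Fin 2)) (φ : ℝ → UnitAddTorus (Fin 2) → ℝ),
          FunctionSpaces.Torus.IsClassicalNSSolutionOn (Ico (0 : ℝ) 1) ν (planarForce P) V φ → V 0 = 0 →
            (∫ s in (0 : ℝ)..horizon r ν A, FluidPDE.Torus.vectorL2Sq (V s - P.field s)) ≤ ε * ν :=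
  approximateSolution_iff_slaving P hδ₀ hd fun ν hν => by
    obtain ⟨⟨V, φ, R, hV, hV0, -⟩, -⟩ := hEx ν hν
    exact ⟨V, φ, hV, hV0⟩

end Summit.AnomalousDissipation.AnomalousDissipation.Theorems.SawtoothPulseCascade.DriftFreeApprox

end
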